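import Literature.MathematicalPhysics.QuantumLattice.SectorPartitionFnCutSum
import Literature.MathematicalPhysics.QuantumLattice.TorusSectorPartitionFnTiling
import HarnessLib

/-!
# The torus canonical partition function dominates the CONVOLUTION POWER of the open-box canonical
# partition functions (sector-mixing product trial states)

Family `hubbard` (topic `MathematicalPhysics/QuantumLattice`). `TorusSectorPartitionFnTiling.lean` proves
`Π_{ij} Re Z_β(H^open_{a×b}; a_ij, b_ij) ≤ Re Z_β(H^torus_{K_x a × K_y b}; Σ a_ij, Σ b_ij)` for ONE assignment
of particle numbers to the boxes. Summing over all assignments with a fixed total — the canonical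
partition function of a uniform MIXTURE over assignments, which carries the mixing entropy — is
organised here with GENERATING FUNCTIONS: to a box with canonical data `z(a,b) ≤ Re Z_β(H^open; a, b)`
attach the element `P = Σ_{(a,b)} z(a,b) X^{(a,b)}` of the monoid algebra `ℝ[ℕ × ℕ]`
(`AddMonoidAlgebra ℝ (ℕ × ℕ)`); products of such elements are convolutions over the splittings of the
particle numbers (`coeff_mul_eq_sum_splits`), and the summed cut
`partitionFn_twoGraph_sector_cut_sum_of_induced` (`SectorPartitionFnCutSum.lean`) is exactly the statement
that the cut respects this product. Results (`β ≥ 0`):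

* §1 `sectorSplits`, `coeff_mul_eq_sum_splits`, nonnegativity of coefficients of products and powers;
* §2 `coeff_prod_le_partitionFn_strips` — STRIPS of `Fin (KM) ×ₗ Fin b` for ANY two bond sets:
  if `0 ≤ P_i ≤ Z_β(H|strip i)` coefficientwise then `(Π_i P_i)(A,B) ≤ Re Z_β(H; A, B)`;
* §3 `coeff_prod_le_partitionFn_blocks` — BLOCKS of `Fin (K_x a) ×ₗ Fin (K_y b)`;
* §4 `coeff_pow_le_partitionFn_rectTorus` — **the torus dominates the convolution power of its open
  boxes**: for `K_x, K_y ≥ 2` and `0 ≤ P ≤ Z_β(H^open_{a×b})` coefficientwise,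
  `(P^{K_x K_y})(A, B) ≤ Re Z_β(H^torus_{K_x a × K_y b}; A, B)`. Expanding the power by the multinomial
  theorem exhibits, for every TYPE `m` (how many boxes carry which sector), the term
  `multinomial(m) · Π_s z(s)^{m_s}` — the free energy of the type-class product trial state, the
  certificate C2 of the `hubbard-thermal` free-energy programme (`TorusSectorPressureTypeBound.lean`).

[cite: Ruelle1969, §3.3] [cite: Israel1979, Lemma II.3.1] [cite: LeBlancEtAl2015, eq. (1)]. Everything is
PROVED; `sectorSplits` is bookkeeping (an explicit finite set of splittings); no named fact.
-/

noncomputable section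

namespace Literature.MathematicalPhysics.QuantumLattice

open Matrix Finset HubbardWave0 ThermodynamicLimit LiebThm1 AddMonoidAlgebra
open scoped ComplexOrder BigOperators

/-! ### §1 Splittings; coefficients of products in `ℝ[ℕ × ℕ]` -/

section Splits

/-- The splittings `(p₁, p₂)` of the particle numbers `(A, B)` (`p₁ + p₂ = (A, B)`), listed by the second
share `p₂ ∈ [0, A] × [0, B]`. [cite: Ruelle1969, §3.3] -/
def sectorSplits (A B : ℕ) : Finset ((ℕ × ℕ) × (ℕ × ℕ)) :=
  (Finset.range (A + 1) ×ˢ Finset.range (B + 1)).image fun q => ((A - q.1, B - q.2), q)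

/-- Membership in `sectorSplits`: exactly the pairs summing to `(A, B)`. [cite: Ruelle1969, §3.3] -/
theorem mem_sectorSplits {A B : ℕ} {p : (ℕ × ℕ) × (ℕ × ℕ)} : p ∈ sectorSplits A B ↔ p.1 + p.2 = (A, B) := by
  constructor
  · intro h
    obtain ⟨q, hq, rfl⟩ := Finset.mem_image.1 h
    obtain ⟨h1, h2⟩ := Finset.mem_product.1 hq
    have h1' := Finset.mem_range.1 h1
    have h2' := Finset.mem_range.1 h2
    refine Prod.ext ?_ ?_
    · show A - q.1 + q.1 = A
      omega
    · show B - q.2 + q.2 = B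
      omega
  · intro h
    have h1 : p.1.1 + p.2.1 = A := by simpa using congrArg Prod.fst h
    have h2 : p.1.2 + p.2.2 = B := by simpa using congrArg Prod.snd h
    refine Finset.mem_image.2 ⟨p.2, Finset.mem_product.2 ⟨Finset.mem_range.2 (by omega),
      Finset.mem_range.2 (by omega)⟩, ?_⟩
    refine Prod.ext (Prod.ext ?_ ?_) rfl
    · show A - p.2.1 = p.1.1
      omega
    · show B - p.2.2 = p.1.2
      omega

/-- **Products are convolutions over the splittings**: for `x, y ∈ ℝ[ℕ × ℕ]`,
`(x·y)(A,B) = Σ_{(a₂,b₂) ∈ [0,A]×[0,B]} x(A−a₂, B−b₂) · y(a₂, b₂)`. [cite: Ruelle1969, §3.3] -/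
theorem coeff_mul_eq_sum_splits (x y : AddMonoidAlgebra ℝ (ℕ × ℕ)) (A B : ℕ) :
    (x * y).coeff (A, B) =
      ∑ q ∈ Finset.range (A + 1) ×ˢ Finset.range (B + 1), x.coeff (A - q.1, B - q.2) * y.coeff q := by
  rw [coeff_mul_antidiag x y (A, B) (sectorSplits A B) (fun {p} => mem_sectorSplits), sectorSplits,
    Finset.sum_image]
  intro q _ q' _ h
  exact (Prod.mk.inj h).2

/-- The unit of `ℝ[ℕ × ℕ]` has coefficients `δ_{(0,0)}`. [cite: Ruelle1969, §3.3] -/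
theorem coeff_one_pair (A B : ℕ) :
    (1 : AddMonoidAlgebra ℝ (ℕ × ℕ)).coeff (A, B) = if A = 0 ∧ B = 0 then 1 else 0 := by
  classical
  rw [one_def, coeff_single, Finsupp.single_apply]
  by_cases h : A = 0 ∧ B = 0
  · rw [if_pos h, if_pos (by rw [h.1, h.2]; rfl)]
  · rw [if_neg h, if_neg]
    intro h0
    exact h ⟨(congrArg Prod.fst h0).symm, (congrArg Prod.snd h0).symm⟩

/-- Products of elements with nonnegative coefficients have nonnegative coefficients. [cite: Ruelle1969, §3.3] -/
theorem coeff_mul_nonneg_of_nonneg {x y : AddMonoidAlgebra ℝ (ℕ × ℕ)} (hx : ∀ m, 0 ≤ x.coeff m)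
    (hy : ∀ m, 0 ≤ y.coeff m) : ∀ m, 0 ≤ (x * y).coeff m := by
  rintro ⟨A, B⟩
  rw [coeff_mul_eq_sum_splits]
  exact Finset.sum_nonneg fun q _ => mul_nonneg (hx _) (hy _)

/-- Finite products of elements with nonnegative coefficients have nonnegative coefficients.
[cite: Ruelle1969, §3.3] -/
theorem coeff_prod_nonneg_of_nonneg {ι : Type*} (s : Finset ι) {P : ι → AddMonoidAlgebra ℝ (ℕ × ℕ)}
    (hP : ∀ i ∈ s, ∀ m, 0 ≤ (P i).coeff m) : ∀ m, 0 ≤ (∏ i ∈ s, P i).coeff m := by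
  classical
  induction s using Finset.induction_on with
  | empty =>
      rintro ⟨A, B⟩
      rw [Finset.prod_empty, coeff_one_pair]
      split_ifs <;> norm_num
  | insert i s hi ih =>
      rw [Finset.prod_insert hi]
      exact coeff_mul_nonneg_of_nonneg (hP i (Finset.mem_insert_self i s))
        (ih fun j hj => hP j (Finset.mem_insert_of_mem hj))

/-- Powers of an element with nonnegative coefficients have nonnegative coefficients. [cite: Ruelle1969, §3.3] -/
theorem coeff_pow_nonneg_of_nonneg {P : AddMonoidAlgebra ℝ (ℕ × ℕ)} (hP : ∀ m, 0 ≤ P.coeff m) :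
    ∀ (n : ℕ) (m : ℕ × ℕ), 0 ≤ (P ^ n).coeff m := by
  intro n
  induction n with
  | zero =>
      rintro ⟨A, B⟩
      rw [pow_zero, coeff_one_pair]
      split_ifs <;> norm_num
  | succ n ih =>
      rw [pow_succ]
      exact coeff_mul_nonneg_of_nonneg ih hP

end Splits

/-! ### §2 Strips of `Fin (KM) ×ₗ Fin b`: the product of strip generating functions -/

section Strips

variable {b : ℕ}

/-- The lower block of the cut at `K M` followed by the `i`-th strip of `Fin (K M) ×ₗ Fin b` is the
`i`-th strip of `Fin (K M + M) ×ₗ Fin b` (copy of the private lemma of `TorusSectorPartitionFnTiling`).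
[cite: Ruelle1969, §3.3] -/
private theorem rectCastAdd_comp_stripEmb'' {M K : ℕ} (h₁ : K * M = K * M) (h₂ : K * M + M = (K + 1) * M)
    (i : Fin K) :
    rectCastAdd (K * M) M b ∘ stripEmb h₁ i = stripEmb (b := b) h₂ (Fin.castSucc i) := by
  funext p
  refine ofLex.injective (Prod.ext (Fin.ext ?_) ?_)
  · simp [rectCastAdd, stripEmb]
  · simp [rectCastAdd, stripEmb]

/-- The upper block of the cut at `K M` is the last strip of `Fin (K M + M) ×ₗ Fin b`. [cite: Ruelle1969, §3.3] -/
private theorem rectNatAdd_eq_stripEmb'' {M K : ℕ} (h₂ : K * M + M = (K + 1) * M) :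
    rectNatAdd (K * M) M b = stripEmb (b := b) h₂ (Fin.last K) := by
  funext p
  refine ofLex.injective (Prod.ext (Fin.ext ?_) ?_)
  · simp [rectNatAdd, stripEmb]
  · simp [rectNatAdd, stripEmb]

variable {Λ : Type*} [LinearOrder Λ] [Fintype Λ] in
/-- Two decidability structures on the same adjacency give the same Hubbard Hamiltonian. [cite: LiebPRL1989, eq. (1)] -/
private theorem hamiltonian_congr'' {G₁ G₂ : SimpleGraph Λ} [DecidableRel G₁.Adj] [DecidableRel G₂.Adj]
    (h : G₁ = G₂) (t U : ℝ) : hamiltonian G₁ t U = hamiltonian G₂ t U := by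
  subst h
  congr!

/-- **Strips: the product of the strip generating functions is dominated by the canonical partition
function.** For ANY two bond sets `G, G'` on `Fin A ×ₗ Fin b`, `A = K M`, elements `P_i ∈ ℝ[ℕ × ℕ]` with
`0 ≤ P_i(c,d) ≤ Re Z_β(H_{G|strip i, G'|strip i}; c, d)` for all `(c,d)`, and `β ≥ 0`:
`(Π_i P_i)(A', B') ≤ Re Z_β(H_{G,G'}; A', B')` for every target `(A', B')` — the convolution over all
assignments of particle numbers to the strips (iterate the summed penalty-free cut, splitting off the
last strip). [cite: Ruelle1969, §3.3] [cite: Israel1979, Lemma II.3.1] -/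
theorem coeff_prod_le_partitionFn_strips (M : ℕ) (t U t' U' : ℝ) {β : ℝ} (hβ : 0 ≤ β) :
    ∀ (K A : ℕ) (hA : A = K * M) (G G' : SimpleGraph (Fin A ×ₗ Fin b)) [DecidableRel G.Adj]
      [DecidableRel G'.Adj] (P : Fin K → AddMonoidAlgebra ℝ (ℕ × ℕ))
      (_hP0 : ∀ i m, 0 ≤ (P i).coeff m)
      (_hP : ∀ i c d, (P i).coeff (c, d) ≤ (partitionFn β (spinSectorHamiltonian c d
          (hamiltonian (G.comap (stripEmb hA i)) t U + hamiltonian (G'.comap (stripEmb hA i)) t' U'))).re)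
      (c d : ℕ),
      (∏ i, P i).coeff (c, d) ≤
        (partitionFn β (spinSectorHamiltonian c d (hamiltonian G t U + hamiltonian G' t' U'))).re := by
  intro K
  induction K with
  | zero =>
      intro A hA G G' _ _ P _ _ c d
      rw [Fin.prod_univ_zero, coeff_one_pair]
      split_ifs with h
      · rw [h.1, h.2]
        exact one_le_partitionFn_spinSector_zero_re G G' t U t' U' β
      · exact partitionFn_spinSector_re_nonneg _ _
          ((hamiltonian_isHermitian _ t U).add (hamiltonian_isHermitian _ t' U')) β
  | succ K ih =>
      intro A hA G G' _ _ P hP0 hP c d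
      have hA' : A = K * M + M := by rw [hA]; ring
      subst hA'
      rw [Fin.prod_univ_castSucc, coeff_mul_eq_sum_splits]
      -- the cut into the lower `K` strips and the last strip (induced bond sets, no penalty), summed
      set e₁ : (Fin (K * M) ×ₗ Fin b) ↪ (Fin (K * M + M) ×ₗ Fin b) :=
        ⟨rectCastAdd (K * M) M b, (strictMono_rectCastAdd (K * M) M b).injective⟩ with he₁
      set e₂ : (Fin M ×ₗ Fin b) ↪ (Fin (K * M + M) ×ₗ Fin b) :=
        ⟨rectNatAdd (K * M) M b, (strictMono_rectNatAdd (K * M) M b).injective⟩ with he₂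
      have hT : ∀ q ∈ Finset.range (c + 1) ×ˢ Finset.range (d + 1), q.1 ≤ c ∧ q.2 ≤ d := by
        intro q hq
        obtain ⟨h1, h2⟩ := Finset.mem_product.1 hq
        exact ⟨Nat.lt_succ_iff.1 (Finset.mem_range.1 h1), Nat.lt_succ_iff.1 (Finset.mem_range.1 h2)⟩
      have hcut := partitionFn_twoGraph_sector_cut_sum_of_induced G G' (e₁ := e₁) (e₂ := e₂)
        (strictMono_rectCastAdd (K * M) M b) (strictMono_rectNatAdd (K * M) M b)
        (rectCastAdd_lt_rectNatAdd (K * M) M b) (rectCastAdd_cover (K * M) M b) t U t' U' hβ c d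
        (Finset.range (c + 1) ×ˢ Finset.range (d + 1)) hT
      have hE₁ : (e₁ : Fin (K * M) ×ₗ Fin b → Fin (K * M + M) ×ₗ Fin b) = rectCastAdd (K * M) M b := rfl
      have hE₂ : (e₂ : Fin M ×ₗ Fin b → Fin (K * M + M) ×ₗ Fin b) = rectNatAdd (K * M) M b := rfl
      rw [hE₁, hE₂] at hcut
      refine le_trans (Finset.sum_le_sum fun q hq => ?_) hcut
      -- identify the strips
      have hG : ∀ i : Fin K, (G.comap (rectCastAdd (K * M) M b)).comap (stripEmb rfl i) =
          G.comap (stripEmb hA (Fin.castSucc i)) := by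
        intro i
        rw [SimpleGraph.comap_comap, rectCastAdd_comp_stripEmb'' rfl hA]
      have hG' : ∀ i : Fin K, (G'.comap (rectCastAdd (K * M) M b)).comap (stripEmb rfl i) =
          G'.comap (stripEmb hA (Fin.castSucc i)) := by
        intro i
        rw [SimpleGraph.comap_comap, rectCastAdd_comp_stripEmb'' rfl hA]
      have hL : G.comap (rectNatAdd (K * M) M b) = G.comap (stripEmb hA (Fin.last K)) := by
        rw [rectNatAdd_eq_stripEmb'' hA]
      have hL' : G'.comap (rectNatAdd (K * M) M b) = G'.comap (stripEmb hA (Fin.last K)) := by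
        rw [rectNatAdd_eq_stripEmb'' hA]
      -- the lower block by induction (all sectors)
      have hih := ih (K * M) rfl (G.comap (rectCastAdd (K * M) M b)) (G'.comap (rectCastAdd (K * M) M b))
        (fun i => P (Fin.castSucc i)) (fun i => hP0 (Fin.castSucc i))
        (fun i c' d' => by
          rw [hamiltonian_congr'' (hG i), hamiltonian_congr'' (hG' i)]
          exact hP (Fin.castSucc i) c' d')
        (c - q.1) (d - q.2)
      have hlast := hP (Fin.last K) q.1 q.2
      rw [← hamiltonian_congr'' hL, ← hamiltonian_congr'' hL'] at hlast
      have h0lower : 0 ≤ (∏ i : Fin K, P (Fin.castSucc i)).coeff (c - q.1, d - q.2) :=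
        coeff_prod_nonneg_of_nonneg _ (fun i _ => hP0 (Fin.castSucc i)) _
      have h0last : 0 ≤ (partitionFn β (spinSectorHamiltonian q.1 q.2
          (hamiltonian (G.comap (rectNatAdd (K * M) M b)) t U +
            hamiltonian (G'.comap (rectNatAdd (K * M) M b)) t' U'))).re :=
        partitionFn_spinSector_re_nonneg _ _
          ((hamiltonian_isHermitian _ t U).add (hamiltonian_isHermitian _ t' U')) β
      exact mul_le_mul hih hlast (hP0 _ _) (h0lower.trans hih)

end Strips

/-! ### §3 Blocks of `Fin (K_x a) ×ₗ Fin (K_y b)`: strips, transpose, strips -/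

section Blocks

/-- Strip `i` in the first coordinate, swap, strip `j`, swap back = block `(i, j)` (copy of the private
lemma of `TorusSectorPartitionFnTiling`). [cite: Ruelle1969, §3.3] -/
private theorem stripEmb_swap_stripEmb_swap'' {a b Kx Ky A B : ℕ} (hA : A = Kx * a) (hB : B = Ky * b)
    (i : Fin Kx) (j : Fin Ky) :
    stripEmb (b := B) hA i ∘ rectSwap B a ∘ stripEmb (b := a) hB j ∘ rectSwap a b =
      blockEmb hA hB i j := by
  funext p
  rfl

/-- **Blocks: the product of the block generating functions is dominated by the canonical partition
function.** For ANY two bond sets `G, G'` on `Fin A ×ₗ Fin B` with `A = K_x a`, `B = K_y b`, elements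
`P_ij ∈ ℝ[ℕ × ℕ]` with `0 ≤ P_ij(c,d) ≤ Re Z_β(H_{G|block ij, G'|block ij}; c, d)`, and `β ≥ 0`:
`(Π_{ij} P_ij)(A', B') ≤ Re Z_β(H_{G,G'}; A', B')` (strips in the first coordinate, the coordinate swap,
strips again, swap back). [cite: Ruelle1969, §3.3] [cite: Israel1979, Lemma II.3.1] -/
theorem coeff_prod_le_partitionFn_blocks (a b : ℕ) (t U t' U' : ℝ) {β : ℝ} (hβ : 0 ≤ β) (Kx Ky A B : ℕ)
    (hA : A = Kx * a) (hB : B = Ky * b) (G G' : SimpleGraph (Fin A ×ₗ Fin B))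
    [DecidableRel G.Adj] [DecidableRel G'.Adj] (P : Fin Kx → Fin Ky → AddMonoidAlgebra ℝ (ℕ × ℕ))
    (hP0 : ∀ i j m, 0 ≤ (P i j).coeff m)
    (hP : ∀ i j c d, (P i j).coeff (c, d) ≤ (partitionFn β (spinSectorHamiltonian c d
        (hamiltonian (G.comap (blockEmb hA hB i j)) t U +
          hamiltonian (G'.comap (blockEmb hA hB i j)) t' U'))).re)
    (c d : ℕ) :
    (∏ i, ∏ j, P i j).coeff (c, d) ≤
      (partitionFn β (spinSectorHamiltonian c d (hamiltonian G t U + hamiltonian G' t' U'))).re := by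
  -- strips in the first coordinate, with the strip generating functions `Q_i = Π_j P_ij`
  refine coeff_prod_le_partitionFn_strips (b := B) a t U t' U' hβ Kx A hA G G' (fun i => ∏ j, P i j)
    (fun i => coeff_prod_nonneg_of_nonneg _ fun j _ => hP0 i j) (fun i c' d' => ?_) c d
  -- strip `i`: swap, strips in the (new) first coordinate, swap back
  rw [← partitionFn_spinSector_twoGraph_comap_rectSwap (G.comap (stripEmb hA i)) (G'.comap (stripEmb hA i))]
  refine coeff_prod_le_partitionFn_strips (b := a) b t U t' U' hβ Ky B hB
    ((G.comap (stripEmb hA i)).comap (rectSwap B a)) ((G'.comap (stripEmb hA i)).comap (rectSwap B a))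
    (fun j => P i j) (fun j => hP0 i j) (fun j c'' d'' => ?_) c' d'
  rw [← partitionFn_spinSector_twoGraph_comap_rectSwap
    ((((G.comap (stripEmb hA i)).comap (rectSwap B a))).comap (stripEmb hB j))
    ((((G'.comap (stripEmb hA i)).comap (rectSwap B a))).comap (stripEmb hB j))]
  have hG : (((G.comap (stripEmb hA i)).comap (rectSwap B a)).comap (stripEmb hB j)).comap
      (rectSwap a b) = G.comap (blockEmb hA hB i j) := by
    simp only [SimpleGraph.comap_comap]
    rw [← stripEmb_swap_stripEmb_swap'' hA hB i j]
    rfl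
  have hG' : (((G'.comap (stripEmb hA i)).comap (rectSwap B a)).comap (stripEmb hB j)).comap
      (rectSwap a b) = G'.comap (blockEmb hA hB i j) := by
    simp only [SimpleGraph.comap_comap]
    rw [← stripEmb_swap_stripEmb_swap'' hA hB i j]
    rfl
  rw [hamiltonian_congr'' hG, hamiltonian_congr'' hG']
  exact hP i j c'' d''

end Blocks

/-! ### §4 The torus dominates the convolution power of its open boxes -/

section OpenBox

/-- **The torus canonical partition function dominates the convolution power of the open-box canonical
data** (sector-mixing cluster variational principle for the `t–t'` Hubbard torus `ℤ/K_x aℤ × ℤ/K_y bℤ`,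
`K_x, K_y ≥ 2`): for `β ≥ 0` and every `P ∈ ℝ[ℕ × ℕ]` with `0 ≤ P(c,d) ≤ Re Z_β(H^open_{a×b}; c, d)` for all
`(c, d)` (`H^open = hubbardOpenBoxTT' a b t t' U`):
`(P^{K_x K_y})(A', B') ≤ Re Z_β(H^torus_{K_x a × K_y b}; A', B')` for every target sector `(A', B')` —
the coefficient on the left is the sum, over all assignments of box particle numbers with total `(A',B')`,
of the products of the box data: the uniform mixture over assignments of the box canonical Gibbs states is
a trial state of the torus sector, and its free energy carries the mixing entropy.
[cite: Ruelle1969, §3.3] [cite: Israel1979, Lemma II.3.1] [cite: LeBlancEtAl2015, eq. (1)] -/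
theorem coeff_pow_le_partitionFn_rectTorus (a b Kx Ky : ℕ) (hKx : 2 ≤ Kx) (hKy : 2 ≤ Ky)
    (t t' U : ℝ) {β : ℝ} (hβ : 0 ≤ β) (P : AddMonoidAlgebra ℝ (ℕ × ℕ)) (hP0 : ∀ m, 0 ≤ P.coeff m)
    (hP : ∀ c d, P.coeff (c, d) ≤
      (partitionFn β (spinSectorHamiltonian c d (hubbardOpenBoxTT' a b t t' U))).re)
    (A' B' : ℕ) :
    (P ^ (Kx * Ky)).coeff (A', B') ≤
      (partitionFn β (spinSectorHamiltonian A' B' (hubbardRectTorusTT' (Kx * a) (Ky * b) t t' U))).re := by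
  have h := coeff_prod_le_partitionFn_blocks a b t U t' 0 hβ Kx Ky (Kx * a) (Ky * b) rfl rfl
    (fermionRectTorusGraph (Kx * a) (Ky * b)) (fermionRectTorusDiagGraph (Kx * a) (Ky * b)) (fun _ _ => P)
    (fun _ _ => hP0) (fun i j c d => by
      rw [hamiltonian_congr'' (comap_blockEmb_fermionRectTorusGraph' hKx hKy rfl rfl i j),
        hamiltonian_congr'' (comap_blockEmb_fermionRectTorusDiagGraph' hKx hKy rfl rfl i j)]
      exact hP c d) A' B'
  have e3 : (∏ _i : Fin Kx, ∏ _j : Fin Ky, P) = P ^ (Kx * Ky) := by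
    simp only [Finset.prod_const, Finset.card_univ, Fintype.card_fin]
    rw [← pow_mul, mul_comm]
  rw [e3] at h
  exact h

end OpenBox

end Literature.MathematicalPhysics.QuantumLattice

end
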